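import Summits.MatrixMultiplication.MatrixMultiplication.Theorems.LevelGradedCohnUmansLevelOneGL2DesignsTangencyPlaneSRSBound

/-!
# Unitals give extremal strong representative systems — stub `stub_tangencySets` (crux
`LevelOneGL2Designs`, stmt-MatrixMultiplication-14080), wall-breaker axis 10/12 "Hermitian unital
constructions", generation 1 (seat 3), part 2 (the converse direction)

Part 1 (`…TangencyPlaneUnital`) shows that a strong representative system `S` (flags `(pᵢ, ℓᵢ)`
with `pᵢ ∈ ℓⱼ ↔ i = j`) of a projective plane of order `n` with `(|S| − 1)² = n³` has a unital as point
set.  This file is the converse half of "ISW is sharp exactly at the unitals", again for Mathlib's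
abstract `Configuration.ProjectivePlane`, with a unital given by its defining property (no new
definition): a set `U` of `r³ + 1` points of a plane of order `r²` met by every line in `1` or `r + 1`
points.

* `unital_tangent_card_eq_one` — each point of a unital lies on EXACTLY ONE tangent (a line meeting
  `U` only there): the `r² + 1` lines through `u` cover the other `r³` points once each, so `t`
  tangents and `r² + 1 − t` secants give `r(r² + 1 − t) = r³`, `t = 1`;
* `unital_srs` — hence the point–tangent flags of `U` form a strong representative system with point
  set `U` and `(|S| − 1)² = (r²)³`, i.e. equality in the Illés–Szőnyi–Wettl bound
  `PlaneSRS.srs_card_sub_one_sq_le`.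

Over `PG(2,q²)` the Hermitian curve is such a `U`, and `FlagLine.TangencyHermitian.hermitian_srs` (axis
10, generation 0) is the affine part of the resulting system; over a plane of prime order no `U`
exists (`r² = p` has no solution), which is the whole difficulty of `stub_tangencySets`.
Sources: J. A. Thas, Geom. Dedicata 3 (1974); Illés–Szőnyi–Wettl 1991 (Zbl 0741.51013); Barwick–Ebert,
*Unitals in projective planes* (Springer 2008), Ch. 1 for the tangent count.  Elementary;
Mathlib + `…TangencyPlaneSRSBound` (for `PlaneSRS.card_filter_mem_line_pair`); no definitions.
-/

-- `Summit.MatrixMultiplication.MatrixMultiplication.…` is the tree's mandated summit/problem namespace (D-0017).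
set_option linter.dupNamespace false

namespace Summit.MatrixMultiplication.MatrixMultiplication.Theorems.LevelOneGL2Designs.PlaneUnital

open Finset Configuration
open Summit.MatrixMultiplication.MatrixMultiplication.Theorems.LevelOneGL2Designs.PlaneSRS
  (card_filter_mem_line_pair)

variable {P L : Type*} [Membership P L] [Configuration.ProjectivePlane P L] [Fintype P] [Fintype L]

/-! ## The converse: unitals give extremal systems -/

open scoped Classical in
/-- **Each point of a unital lies on exactly one tangent.**  Let the plane have order `r²` and let
`U` be a set of `r³ + 1` points met by every line in `1` or `r + 1` points (a unital).  Then through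
each `u ∈ U` passes exactly one line meeting `U` only in `u`.  (The `r² + 1` lines through `u` cover
the other `r³` points of `U` once each; `t` tangents and `r² + 1 − t` secants give
`r(r² + 1 − t) = r³`, so `t = 1`.) [folklore; e.g. Barwick–Ebert, *Unitals in projective planes*, §1] -/
theorem unital_tangent_card_eq_one (r : ℕ) (hr : ProjectivePlane.order P L = r ^ 2)
    (U : Finset P) (hU : U.card = r ^ 3 + 1)
    (hsec : ∀ ℓ : L, (U.filter fun v => v ∈ ℓ).card = 1 ∨ (U.filter fun v => v ∈ ℓ).card = r + 1)
    (u : P) (hu : u ∈ U) :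
    (univ.filter fun ℓ : L => u ∈ ℓ ∧ (U.filter fun v => v ∈ ℓ).card = 1).card = 1 := by
  set n : ℕ := ProjectivePlane.order P L with hn_def
  have hn1 : 1 < n := ProjectivePlane.one_lt_order P L
  have hrpos : 0 < r := by
    rcases Nat.eq_zero_or_pos r with h0 | hpos
    · rw [h0] at hr
      omega
    · exact hpos
  -- the pencil of `u`
  set A : Finset L := univ.filter fun ℓ : L => u ∈ ℓ with hA_def
  have hAcard : A.card = n + 1 := by
    rw [hA_def, ← ProjectivePlane.lineCount_eq L u, Configuration.lineCount, Nat.card_eq_fintype_card,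
      Fintype.card_subtype]
  -- incidences between the pencil and `U`
  have hinc : ∑ ℓ ∈ A, (U.filter fun v => v ∈ ℓ).card = n + U.card := by
    have h1 : ∀ ℓ ∈ A, (U.filter fun v => v ∈ ℓ).card = ∑ v ∈ U, if v ∈ ℓ then 1 else 0 :=
      fun ℓ _ => Finset.card_filter _ _
    rw [Finset.sum_congr rfl h1, Finset.sum_comm]
    have h2 : ∀ v ∈ U, (∑ ℓ ∈ A, if v ∈ ℓ then 1 else 0) = if u = v then n + 1 else 1 := by
      intro v _
      rw [hA_def, Finset.sum_filter, ← card_filter_mem_line_pair u v, Finset.card_filter]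
      refine Finset.sum_congr rfl fun ℓ _ => ?_
      by_cases h1 : u ∈ ℓ <;> by_cases h2 : v ∈ ℓ <;> simp [h1, h2]
    rw [Finset.sum_congr rfl h2, Finset.sum_ite, Finset.sum_const, Finset.sum_const, smul_eq_mul,
      smul_eq_mul, mul_one]
    have hfu : (U.filter fun v => u = v) = {u} := by
      ext v
      simp only [Finset.mem_filter, Finset.mem_singleton]
      constructor
      · rintro ⟨-, rfl⟩
        rfl
      · rintro rfl
        exact ⟨hu, rfl⟩
    have hfu' : (U.filter fun v => ¬ u = v).card + 1 = U.card := by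
      have := Finset.card_filter_add_card_filter_not (s := U) (fun v => u = v)
      rw [hfu, Finset.card_singleton] at this
      omega
    rw [hfu, Finset.card_singleton]
    omega
  -- split the pencil into tangents and secants
  set A₁ : Finset L := A.filter fun ℓ => (U.filter fun v => v ∈ ℓ).card = 1 with hA₁_def
  set A₂ : Finset L := A.filter fun ℓ => ¬ (U.filter fun v => v ∈ ℓ).card = 1 with hA₂_def
  have hA12 : A₁.card + A₂.card = n + 1 := by
    rw [hA₁_def, hA₂_def, Finset.card_filter_add_card_filter_not, hAcard]
  have hsplit : ∑ ℓ ∈ A, (U.filter fun v => v ∈ ℓ).card =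
      ∑ ℓ ∈ A₁, (U.filter fun v => v ∈ ℓ).card + ∑ ℓ ∈ A₂, (U.filter fun v => v ∈ ℓ).card := by
    rw [hA₁_def, hA₂_def, Finset.sum_filter_add_sum_filter_not]
  have hs1 : ∑ ℓ ∈ A₁, (U.filter fun v => v ∈ ℓ).card = A₁.card := by
    rw [Finset.card_eq_sum_ones, hA₁_def]
    exact Finset.sum_congr rfl fun ℓ hℓ => (Finset.mem_filter.mp hℓ).2
  have hs2 : ∑ ℓ ∈ A₂, (U.filter fun v => v ∈ ℓ).card = A₂.card * (r + 1) := by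
    rw [hA₂_def, Finset.sum_congr rfl fun ℓ hℓ => ((hsec ℓ).resolve_left (Finset.mem_filter.mp hℓ).2),
      Finset.sum_const, smul_eq_mul]
  -- arithmetic: `A₁.card + A₂.card (r+1) = r² + r³ + 1`, `A₁.card + A₂.card = r² + 1` ⇒ `A₁.card = 1`
  have hkey : A₁.card + A₂.card * (r + 1) = n + (r ^ 3 + 1) := by
    rw [← hU, ← hinc, hsplit, hs1, hs2]
  rw [hr] at hA12 hkey
  have hA2 : r * A₂.card = r * r ^ 2 := by nlinarith
  have hA2' : A₂.card = r ^ 2 := Nat.eq_of_mul_eq_mul_left hrpos hA2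
  have hA1 : A₁.card = 1 := by omega
  have hAA : (univ.filter fun ℓ : L => u ∈ ℓ ∧ (U.filter fun v => v ∈ ℓ).card = 1) = A₁ := by
    rw [hA₁_def, hA_def, Finset.filter_filter]
  rw [hAA, hA1]

open scoped Classical in
/-- **Unitals give extremal strong representative systems.**  In a projective plane of order `r²`,
a unital `U` (`r³ + 1` points, every line meeting `U` in `1` or `r + 1` points) together with the
tangent at each of its points is a strong representative system `S` with point set `U` attaining
`(|S| − 1)² = (r²)³`: the Illés–Szőnyi–Wettl bound is sharp exactly at the unitals (with
`srs_extremal_structure`).  Over `PG(2,q²)` the Hermitian curve is such a `U`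
(`FlagLine.TangencyHermitian.hermitian_srs` is its affine part). [Thas 1974; Illés–Szőnyi–Wettl 1991] -/
theorem unital_srs (r : ℕ) (hr : ProjectivePlane.order P L = r ^ 2)
    (U : Finset P) (hU : U.card = r ^ 3 + 1)
    (hsec : ∀ ℓ : L, (U.filter fun v => v ∈ ℓ).card = 1 ∨ (U.filter fun v => v ∈ ℓ).card = r + 1) :
    ∃ S : Finset (P × L), S.image Prod.fst = U ∧
      (∀ f ∈ S, ∀ g ∈ S, (f.1 ∈ g.2 ↔ f = g)) ∧
      (S.card - 1) ^ 2 = ProjectivePlane.order P L ^ 3 := by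
  -- a tangent selector
  have key : ∀ u : P, ∃ ℓ : L, u ∈ U → (u ∈ ℓ ∧ (U.filter fun v => v ∈ ℓ).card = 1) := by
    intro u
    by_cases hu : u ∈ U
    · obtain ⟨ℓ, hℓ⟩ := Finset.card_eq_one.mp (unital_tangent_card_eq_one r hr U hU hsec u hu)
      have hmem : ℓ ∈ (univ.filter fun ℓ : L => u ∈ ℓ ∧ (U.filter fun v => v ∈ ℓ).card = 1) := by
        rw [hℓ]
        exact Finset.mem_singleton_self ℓ
      exact ⟨ℓ, fun _ => (Finset.mem_filter.mp hmem).2⟩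
    · have hL : 0 < Fintype.card L := by
        rw [ProjectivePlane.card_lines P L]
        exact Nat.succ_pos _
      obtain ⟨ℓ⟩ := Fintype.card_pos_iff.mp hL
      exact ⟨ℓ, fun h => (hu h).elim⟩
  choose τ hτ using key
  have hinj : Function.Injective fun u : P => (u, τ u) := fun u v h => (Prod.mk.inj h).1
  refine ⟨U.image fun u => (u, τ u), ?_, ?_, ?_⟩
  · rw [Finset.image_image]
    have h : (Prod.fst ∘ fun u : P => (u, τ u)) = id := funext fun u => rfl
    rw [h, Finset.image_id]
  · intro f hf g hg
    obtain ⟨u, hu, rfl⟩ := Finset.mem_image.mp hf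
    obtain ⟨v, hv, rfl⟩ := Finset.mem_image.mp hg
    constructor
    · intro huv
      change u ∈ τ v at huv
      obtain ⟨hvτ, hone⟩ := hτ v hv
      obtain ⟨w, hw⟩ := Finset.card_eq_one.mp hone
      have hu' : u ∈ U.filter fun x => x ∈ τ v := Finset.mem_filter.mpr ⟨hu, huv⟩
      have hv' : v ∈ U.filter fun x => x ∈ τ v := Finset.mem_filter.mpr ⟨hv, hvτ⟩
      rw [hw, Finset.mem_singleton] at hu' hv'
      rw [hu', hv']
    · intro h
      have huv : u = v := (Prod.mk.inj h).1
      subst huv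
      exact (hτ u hu).1
  · rw [Finset.card_image_of_injective U hinj, hU, hr]
    simp only [Nat.add_sub_cancel]
    ring

end Summit.MatrixMultiplication.MatrixMultiplication.Theorems.LevelOneGL2Designs.PlaneUnital
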